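import Literature.NumberTheory.Automorphic.LevelActionReductionKernel
import Literature.Algebra.Homology.GroupCohomologyModPiFinite
import Literature.Algebra.Homology.GroupCohomologySemilinearBijective
import Mathlib.RepresentationTheory.Homological.GroupCohomology.LongExactSequence
import HarnessLib

/-!
# The connecting homomorphism `H^i(U, V/ϖV) → H^{i+1}(U, V)` in the coefficients-at-`p` model

Topic `NumberTheory/Automorphic`; namespace `Literature.NumberTheory.Automorphic.LevelAction`;
definitions with bodies and theorems (no named fact, no `sorry`).  Universe `u`.

For the sections `M(U, τ)` of `LevelAction` (coefficients `τ : Δ → End_R V`), an element `ϖ ∈ R`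
injective on `V`, and a SURJECTIVE `σ`-semilinear equivariant coefficient map `φ : V → V'`
(`τ'` on `V'` over `R'`) with `ker φ = ϖV` (the reduction `V → V/ϖV` up to the change of rings
`σ : R → R'`), we connect Mathlib's long exact sequence of `0 → M(U,τ) →ϖ M(U,τ) → M(U,τ)/ϖ → 0`
(`GroupCohomologyModPiFinite.smul_shortExact`) with the `R'`-linear cohomology `H^i(U, τ')`:

* `modCompare` — the bijective semilinear equivariant comparison `M(U,τ)/ϖ → M(U,τ')`
  (`sectionsSemimap_eq_zero_iff`, `sectionsSemimap_surjective`), and `modCompareCoh`, the induced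
  bijection `H^i(Γ, M(U,τ)/ϖ) → H^i(U, τ')` (`semimap_bijective_of_bijective`) identifying
  `H^i(mkQ)` with `cohomologySemimap φ` and the quotient Hecke endomorphisms with `[UβU]`;
* **`reductionDelta i j`** — the connecting homomorphism `δ : H^i(U, τ') →+ H^j(U, τ)` (`j = i+1`);
* **`exists_of_reductionDelta_eq_zero`**, `reductionDelta_cohomologySemimap` — exactness at
  `H^i(U, τ')`: `ker δ = range (cohomologySemimap φ)`;
* **`reductionDelta_heckeCohomology`** — `δ ∘ [UβU] = [UβU] ∘ δ` (`groupCohomology.δ_naturality`);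
* `reductionDelta_smul` — `δ (σ(c) y) = c δ(y)`.

[cite: Brown1982CohomologyGroups, III.6 Prop. 6.1] [cite: Hida1994AIF, §3] [cite: KhareThorne2017, §6.4]

## References

* K. S. Brown, *Cohomology of Groups*, GTM 87 (1982), III.6 (held). [Brown1982CohomologyGroups]
* H. Hida, Ann. Inst. Fourier 44 (1994), §3 (held). [Hida1994AIF]
* C. Khare, J. A. Thorne, Amer. J. Math. 139 (2017), §6.4 (arXiv:1409.7007, held). [KhareThorne2017]
-/

noncomputable section

open CategoryTheory Literature.Algebra.Homology groupCohomology
open scoped Pointwise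

namespace Literature.NumberTheory.Automorphic.LevelAction

universe u

variable {R R' : Type u} [CommRing R] [CommRing R'] {σ : R →+* R'} {Γ 𝒢 : Type u} [Group Γ] [Group 𝒢]
  (ι : Γ →* 𝒢) (Δ : Submonoid 𝒢) {V V' : Type u} [AddCommGroup V] [Module R V] [AddCommGroup V']
  [Module R' V'] (τ : Δ →* Module.End R V) (τ' : Δ →* Module.End R' V') (U : Subgroup 𝒢)
  (hU : U.toSubmonoid ≤ Δ) (φ : V →ₛₗ[σ] V') (hφ : ∀ (δ : Δ) (v : V), φ (τ δ v) = τ' δ (φ v)) (ϖ : R)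

/-! ### The short exact sequence `0 → M(U,τ) →ϖ M(U,τ) → M(U,τ)/ϖ → 0` -/

/-- The sections `M(U, τ)` as an object of `Rep R Γ`. [folklore] -/
abbrev secRep : Rep R Γ := Rep.of (rep ι Δ τ U)

/-- `M(U, τ)/ϖ` as an object of `Rep R Γ`. [folklore] -/
abbrev modRep : Rep R Γ :=
  (secRep ι Δ τ U).quotient (ϖ • ⊤) (smul_top_le_comap (secRep ι Δ τ U) ϖ)

/-- The short complex `M(U,τ) →ϖ M(U,τ) → M(U,τ)/ϖ`. [folklore] -/
abbrev smulSeq : ShortComplex (Rep R Γ) :=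
  ShortComplex.mk (ϖ • 𝟙 (secRep ι Δ τ U)) ((secRep ι Δ τ U).mkQ (ϖ • ⊤) (smul_top_le_comap _ ϖ))
    (smul_id_comp_mkQ _ ϖ)

/-- It is short exact when `ϖ` is injective on `V`. [cite: Brown1982CohomologyGroups, III.6] -/
theorem smulSeq_shortExact (htf : ∀ v : V, ϖ • v = 0 → v = 0) : (smulSeq ι Δ τ U ϖ).ShortExact :=
  smul_shortExact (secRep ι Δ τ U) ϖ fun f hf => smul_sections_eq_zero Δ τ U ϖ htf f hf

/-! ### The comparison `M(U,τ)/ϖ ≅ M(U,τ')` -/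

section Compare

variable (htf : ∀ v : V, ϖ • v = 0 → v = 0) (hker : ∀ v : V, φ v = 0 ↔ ∃ v', ϖ • v' = v)

include htf hker in
/-- `ϖ M(U,τ)` is killed by the reduction of sections. [folklore] -/
theorem smul_top_le_ker_sectionsSemimap_of_ker :
    (ϖ • ⊤ : Submodule R (sections Δ τ U)) ≤ LinearMap.ker (sectionsSemimap Δ τ τ' U hU φ hφ) := by
  intro f hf
  obtain ⟨f₀, -, rfl⟩ := (Submodule.mem_smul_pointwise_iff_exists _ _ _).1 hf
  exact (sectionsSemimap_eq_zero_iff Δ τ τ' U hU φ hφ ϖ htf hker _).2 ⟨f₀, rfl⟩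

/-- **The comparison `M(U,τ)/ϖ →ₛₗ[σ] M(U,τ')`.** [folklore] -/
def modCompare : (sections Δ τ U ⧸ (ϖ • ⊤ : Submodule R (sections Δ τ U))) →ₛₗ[σ] sections Δ τ' U :=
  (ϖ • ⊤ : Submodule R (sections Δ τ U)).liftQ (sectionsSemimap Δ τ τ' U hU φ hφ)
    (smul_top_le_ker_sectionsSemimap_of_ker Δ τ τ' U hU φ hφ ϖ htf hker)

/-- `modCompare (mk f) = φ ∘ f`. [folklore] -/
@[simp]
theorem modCompare_mk (f : sections Δ τ U) :
    modCompare Δ τ τ' U hU φ hφ ϖ htf hker (Submodule.Quotient.mk f) = sectionsSemimap Δ τ τ' U hU φ hφ f :=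
  rfl

/-- `modCompare` is equivariant. [folklore] -/
theorem modCompare_equivariant (γ : Γ) (x : sections Δ τ U ⧸ (ϖ • ⊤ : Submodule R (sections Δ τ U))) :
    modCompare Δ τ τ' U hU φ hφ ϖ htf hker ((modRep ι Δ τ U ϖ).ρ γ x) =
      rep ι Δ τ' U γ (modCompare Δ τ τ' U hU φ hφ ϖ htf hker x) := by
  induction x using Submodule.Quotient.induction_on with
  | H f =>
    change modCompare Δ τ τ' U hU φ hφ ϖ htf hker (Submodule.Quotient.mk (rep ι Δ τ U γ f)) = _
    rw [modCompare_mk, modCompare_mk]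
    exact sectionsSemimap_rep ι Δ τ τ' U hU φ hφ γ f

include htf hker in
/-- `modCompare` is injective. [folklore] -/
theorem modCompare_injective : Function.Injective (modCompare Δ τ τ' U hU φ hφ ϖ htf hker) := by
  refine (injective_iff_map_eq_zero _).2 fun x hx => ?_
  induction x using Submodule.Quotient.induction_on with
  | H f =>
    rw [modCompare_mk] at hx
    obtain ⟨f₀, rfl⟩ := (sectionsSemimap_eq_zero_iff Δ τ τ' U hU φ hφ ϖ htf hker f).1 hx
    exact (Submodule.Quotient.mk_eq_zero _).2 (Submodule.smul_mem_pointwise_smul _ _ _ Submodule.mem_top)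

/-- `modCompare` is surjective when `φ` is. [folklore] -/
theorem modCompare_surjective (hsurj : Function.Surjective φ) :
    Function.Surjective (modCompare Δ τ τ' U hU φ hφ ϖ htf hker) := fun f' => by
  obtain ⟨f, rfl⟩ := sectionsSemimap_surjective Δ τ τ' U hU φ hφ hsurj f'
  exact ⟨Submodule.Quotient.mk f, rfl⟩

/-- **`H^i(Γ, M(U,τ)/ϖ) →ₛₗ[σ] H^i(U, τ')`** induced by `modCompare`. [folklore] -/
def modCompareCoh (i : ℕ) : groupCohomology (modRep ι Δ τ U ϖ) i →ₛₗ[σ] cohomology ι Δ τ' U i :=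
  semimap (A := modRep ι Δ τ U ϖ) (B := Rep.of (rep ι Δ τ' U)) (modCompare Δ τ τ' U hU φ hφ ϖ htf hker)
    (fun γ x => modCompare_equivariant ι Δ τ τ' U hU φ hφ ϖ htf hker γ x) i

/-- It is bijective when `φ` is surjective. [folklore] -/
theorem modCompareCoh_bijective (hsurj : Function.Surjective φ) (i : ℕ) :
    Function.Bijective (modCompareCoh ι Δ τ τ' U hU φ hφ ϖ htf hker i) :=
  semimap_bijective_of_bijective (A := modRep ι Δ τ U ϖ) (B := Rep.of (rep ι Δ τ' U)) _ _
    ⟨modCompare_injective Δ τ τ' U hU φ hφ ϖ htf hker, modCompare_surjective Δ τ τ' U hU φ hφ ϖ htf hker hsurj⟩ i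

/-- **`modCompareCoh ∘ H^i(mkQ) = cohomologySemimap φ`.** [folklore] -/
theorem modCompareCoh_map_mkQ (i : ℕ) (x : cohomology ι Δ τ U i) :
    modCompareCoh ι Δ τ τ' U hU φ hφ ϖ htf hker i
        (map (MonoidHom.id Γ) ((secRep ι Δ τ U).mkQ (ϖ • ⊤) (smul_top_le_comap _ ϖ)) i x) =
      cohomologySemimap ι Δ τ τ' U hU φ hφ i x := by
  have h := semimap_map (A := secRep ι Δ τ U) (A₂ := modRep ι Δ τ U ϖ) (B := Rep.of (rep ι Δ τ' U))
    (B₂ := Rep.of (rep ι Δ τ' U)) (sectionsSemimap Δ τ τ' U hU φ hφ)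
    (fun γ f => sectionsSemimap_rep ι Δ τ τ' U hU φ hφ γ f) (modCompare Δ τ τ' U hU φ hφ ϖ htf hker)
    (fun γ x => modCompare_equivariant ι Δ τ τ' U hU φ hφ ϖ htf hker γ x)
    ((secRep ι Δ τ U).mkQ (ϖ • ⊤) (smul_top_le_comap _ ϖ)) (𝟙 _) (fun f => rfl) i x
  rw [groupCohomology.map_id] at h
  exact h

/-! ### The quotient Hecke endomorphisms -/

/-- The Hecke endomorphism `[UβU]` of `M(U,τ)/ϖ` induced from that of `M(U,τ)`. [folklore] -/
def modHecke {β : 𝒢} (hβ : β ∈ Δ) : modRep ι Δ τ U ϖ ⟶ modRep ι Δ τ U ϖ :=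
  Rep.ofHom ⟨(ϖ • ⊤ : Submodule R (sections Δ τ U)).mapQ (ϖ • ⊤) (heckeRepHom ι Δ τ U hU hβ).hom.toLinearMap
      (fun f hf => by
        obtain ⟨f₀, -, rfl⟩ := (Submodule.mem_smul_pointwise_iff_exists _ _ _).1 hf
        rw [Submodule.mem_comap, map_smul]
        exact Submodule.smul_mem_pointwise_smul _ _ _ Submodule.mem_top),
    fun γ => Submodule.linearMap_qext _ (LinearMap.ext fun f => by
      change Submodule.Quotient.mk ((heckeRepHom ι Δ τ U hU hβ).hom (rep ι Δ τ U γ f)) =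
        Submodule.Quotient.mk (rep ι Δ τ U γ ((heckeRepHom ι Δ τ U hU hβ).hom f))
      rw [Rep.hom_comm_apply])⟩

/-- `modHecke (mk f) = mk ([UβU] f)`. [folklore] -/
theorem modHecke_hom_mk {β : 𝒢} (hβ : β ∈ Δ) (f : sections Δ τ U) :
    (modHecke ι Δ τ U hU ϖ hβ).hom (Submodule.Quotient.mk f) =
      Submodule.Quotient.mk ((heckeRepHom ι Δ τ U hU hβ).hom f) :=
  rfl

/-- The Hecke endomorphism of the short exact sequence `0 → M →ϖ M → M/ϖ → 0`. [folklore] -/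
def heckeSeqHom {β : 𝒢} (hβ : β ∈ Δ) : smulSeq ι Δ τ U ϖ ⟶ smulSeq ι Δ τ U ϖ where
  τ₁ := heckeRepHom ι Δ τ U hU hβ
  τ₂ := heckeRepHom ι Δ τ U hU hβ
  τ₃ := modHecke ι Δ τ U hU ϖ hβ
  comm₁₂ := by
    change heckeRepHom ι Δ τ U hU hβ ≫ (ϖ • 𝟙 (secRep ι Δ τ U)) = (ϖ • 𝟙 (secRep ι Δ τ U)) ≫ heckeRepHom ι Δ τ U hU hβ
    rw [Rep.smul_comp, Rep.comp_smul, Category.id_comp, Category.comp_id]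
  comm₂₃ := Rep.hom_ext (Representation.IntertwiningMap.ext (LinearMap.ext fun f => rfl))

/-- **`modCompareCoh ∘ H^i(modHecke β) = [UβU] ∘ modCompareCoh`.** [folklore] -/
theorem modCompareCoh_map_modHecke {β : 𝒢} (hβ : β ∈ Δ) (i : ℕ) (x : groupCohomology (modRep ι Δ τ U ϖ) i) :
    modCompareCoh ι Δ τ τ' U hU φ hφ ϖ htf hker i (map (MonoidHom.id Γ) (modHecke ι Δ τ U hU ϖ hβ) i x) =
      heckeCohomology ι Δ τ' U hU hβ i (modCompareCoh ι Δ τ τ' U hU φ hφ ϖ htf hker i x) :=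
  semimap_map_endo (A := modRep ι Δ τ U ϖ) (B := Rep.of (rep ι Δ τ' U)) _ _
    (modHecke ι Δ τ U hU ϖ hβ) (heckeRepHom ι Δ τ' U hU hβ) (fun y => by
      induction y using Submodule.Quotient.induction_on with
      | H f =>
        rw [modHecke_hom_mk, modCompare_mk, modCompare_mk]
        exact sectionsSemimap_heckeRepHom ι Δ τ τ' U hU φ hφ hβ f) i x

end Compare

/-! ### The connecting homomorphism -/

section Delta

variable (htf : ∀ v : V, ϖ • v = 0 → v = 0) (hker : ∀ v : V, φ v = 0 ↔ ∃ v', ϖ • v' = v)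
  (hsurj : Function.Surjective φ)

/-- The comparison as an additive equivalence. [folklore] -/
def modCompareEquiv (i : ℕ) : groupCohomology (modRep ι Δ τ U ϖ) i ≃+ cohomology ι Δ τ' U i :=
  AddEquiv.ofBijective (modCompareCoh ι Δ τ τ' U hU φ hφ ϖ htf hker i).toAddMonoidHom
    (modCompareCoh_bijective ι Δ τ τ' U hU φ hφ ϖ htf hker hsurj i)

/-- Unfolding `modCompareEquiv`. [folklore] -/
@[simp]
theorem modCompareEquiv_apply (i : ℕ) (x : groupCohomology (modRep ι Δ τ U ϖ) i) :
    modCompareEquiv ι Δ τ τ' U hU φ hφ ϖ htf hker hsurj i x = modCompareCoh ι Δ τ τ' U hU φ hφ ϖ htf hker i x :=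
  rfl

/-- **The connecting homomorphism `δ : H^i(U, τ') →+ H^j(U, τ)`** (`j = i + 1`) of
`0 → V →ϖ V →φ V' → 0`. [cite: Brown1982CohomologyGroups, III.6 Prop. 6.1] [cite: Hida1994AIF, §3] -/
def reductionDelta (i j : ℕ) (hij : i + 1 = j) : cohomology ι Δ τ' U i →+ cohomology ι Δ τ U j :=
  (groupCohomology.δ (smulSeq_shortExact ι Δ τ U ϖ htf) i j hij).hom.toAddMonoidHom.comp
    (modCompareEquiv ι Δ τ τ' U hU φ hφ ϖ htf hker hsurj i).symm.toAddMonoidHom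

/-- `δ (modCompareCoh x) = δ_Mathlib x`. [folklore] -/
theorem reductionDelta_modCompareCoh {i j : ℕ} (hij : i + 1 = j) (x : groupCohomology (modRep ι Δ τ U ϖ) i) :
    reductionDelta ι Δ τ τ' U hU φ hφ ϖ htf hker hsurj i j hij (modCompareCoh ι Δ τ τ' U hU φ hφ ϖ htf hker i x) =
      (groupCohomology.δ (smulSeq_shortExact ι Δ τ U ϖ htf) i j hij).hom x := by
  change (groupCohomology.δ (smulSeq_shortExact ι Δ τ U ϖ htf) i j hij).hom
    ((modCompareEquiv ι Δ τ τ' U hU φ hφ ϖ htf hker hsurj i).symm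
      (modCompareEquiv ι Δ τ τ' U hU φ hφ ϖ htf hker hsurj i x)) = _
  rw [AddEquiv.symm_apply_apply]

/-- **`δ ∘ (reduction) = 0`.** [cite: Brown1982CohomologyGroups, III.6 Prop. 6.1] -/
theorem reductionDelta_cohomologySemimap {i j : ℕ} (hij : i + 1 = j) (x : cohomology ι Δ τ U i) :
    reductionDelta ι Δ τ τ' U hU φ hφ ϖ htf hker hsurj i j hij (cohomologySemimap ι Δ τ τ' U hU φ hφ i x) = 0 := by
  rw [← modCompareCoh_map_mkQ ι Δ τ τ' U hU φ hφ ϖ htf hker i x, reductionDelta_modCompareCoh]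
  have h := (mapShortComplex₃ (smulSeq_shortExact ι Δ τ U ϖ htf) hij).zero
  have h' := congrArg (fun f => f.hom x) h
  exact h'

/-- **Exactness at `H^i(U, τ')`: `δ y = 0 ⇒ y` is the reduction of a class of `H^i(U, τ)`.**
[cite: Brown1982CohomologyGroups, III.6 Prop. 6.1] [cite: Hida1994AIF, §3] -/
theorem exists_of_reductionDelta_eq_zero {i j : ℕ} (hij : i + 1 = j) (y : cohomology ι Δ τ' U i)
    (hy : reductionDelta ι Δ τ τ' U hU φ hφ ϖ htf hker hsurj i j hij y = 0) :
    ∃ x : cohomology ι Δ τ U i, cohomologySemimap ι Δ τ τ' U hU φ hφ i x = y := by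
  obtain ⟨x', rfl⟩ := (modCompareCoh_bijective ι Δ τ τ' U hU φ hφ ϖ htf hker hsurj i).2 y
  rw [reductionDelta_modCompareCoh] at hy
  have hex := (ShortComplex.moduleCat_exact_iff _).1 (mapShortComplex₃_exact (smulSeq_shortExact ι Δ τ U ϖ htf) hij)
  obtain ⟨x, hx⟩ := hex x' hy
  refine ⟨x, ?_⟩
  rw [← modCompareCoh_map_mkQ ι Δ τ τ' U hU φ hφ ϖ htf hker i x]
  exact congrArg _ hx

/-- **`δ` commutes with the Hecke operators `[UβU]`, `β ∈ Δ`.** [cite: Hida1994AIF, §3] [cite: KhareThorne2017, §6.4] -/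
theorem reductionDelta_heckeCohomology {i j : ℕ} (hij : i + 1 = j) {β : 𝒢} (hβ : β ∈ Δ) (y : cohomology ι Δ τ' U i) :
    reductionDelta ι Δ τ τ' U hU φ hφ ϖ htf hker hsurj i j hij (heckeCohomology ι Δ τ' U hU hβ i y) =
      heckeCohomology ι Δ τ U hU hβ j (reductionDelta ι Δ τ τ' U hU φ hφ ϖ htf hker hsurj i j hij y) := by
  obtain ⟨x, rfl⟩ := (modCompareCoh_bijective ι Δ τ τ' U hU φ hφ ϖ htf hker hsurj i).2 y
  rw [← modCompareCoh_map_modHecke ι Δ τ τ' U hU φ hφ ϖ htf hker hβ i x, reductionDelta_modCompareCoh,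
    reductionDelta_modCompareCoh]
  have h := groupCohomology.δ_naturality (smulSeq_shortExact ι Δ τ U ϖ htf) (smulSeq_shortExact ι Δ τ U ϖ htf)
    (heckeSeqHom ι Δ τ U hU ϖ hβ) i j hij
  have h' := congrArg (fun f => f.hom x) h
  exact h'.symm

/-- **`δ (σ(c) y) = c δ(y)`.** [folklore] -/
theorem reductionDelta_smul {i j : ℕ} (hij : i + 1 = j) (c : R) (y : cohomology ι Δ τ' U i) :
    reductionDelta ι Δ τ τ' U hU φ hφ ϖ htf hker hsurj i j hij (σ c • y) =
      c • reductionDelta ι Δ τ τ' U hU φ hφ ϖ htf hker hsurj i j hij y := by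
  obtain ⟨x, rfl⟩ := (modCompareCoh_bijective ι Δ τ τ' U hU φ hφ ϖ htf hker hsurj i).2 y
  rw [← LinearMap.map_smulₛₗ, reductionDelta_modCompareCoh, reductionDelta_modCompareCoh, map_smul]

/-- `δ` is additive (restated for sums). [folklore] -/
theorem reductionDelta_add {i j : ℕ} (hij : i + 1 = j) (y y' : cohomology ι Δ τ' U i) :
    reductionDelta ι Δ τ τ' U hU φ hφ ϖ htf hker hsurj i j hij (y + y') =
      reductionDelta ι Δ τ τ' U hU φ hφ ϖ htf hker hsurj i j hij y +
        reductionDelta ι Δ τ τ' U hU φ hφ ϖ htf hker hsurj i j hij y' :=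
  map_add _ _ _

end Delta

end Literature.NumberTheory.Automorphic.LevelAction
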